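import Summits.BirchSwinnertonDyer.BirchSwinnertonDyer.Theorems.CyclotomicUntwistAmiceCharValues
import Summits.BirchSwinnertonDyer.BirchSwinnertonDyer.Theorems.CyclotomicUntwistUntwistedNonvanishingCofinite
import Summits.BirchSwinnertonDyer.BirchSwinnertonDyer.Theorems.CyclotomicUntwistUntwistingIdentityJacobi
import Summits.BirchSwinnertonDyer.BirchSwinnertonDyer.Theorems.CyclotomicUntwistUntwistingConstantTwentySeven
import HarnessLib

/-!
# The zeros of `𝓛^η_W(T)` at the wild characters ARE the vanishing Birch sums of `f_W`:
# `L_μ(ξ(γ) − 1) = 0 ⟺ ∑_{a mod 3ⁿ} ξ(a)[a/3ⁿ]⁺_f = 0`, for EVERY level `n ≥ 2` on the route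

Cell `pub/bsd-wall` (D-0145 line `route-BirchSwinnertonDyer-CyclotomicUntwist`), seat `bsd-line-cycu-p1`
(prover seat 1/3), helper toward crux K1 `PSRankOneLowerHalfAtThree` (stmt-BirchSwinnertonDyer-21580), D1
currency; sequel of `CyclotomicUntwistAmiceCharValues` (`L_μ(ξ(γ)−1) = ∫_Γ ξ dμ`).  THEOREMS ONLY (no
definition, no named fact, no `sorry`); BSD is not proved by this file and no crux is.

* §1 `hasSum_zero_iff_gammaCharValue_eq_zero` (general `p`, additive of order `< 1`): the Amice series
  vanishes at `T = ξ(γ) − 1` iff `∫_Γ ξ dμ = 0`.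
* §2 `gammaCharValue_eq_zero_iff_jacobi` (general `p`, level `n = c`): for `IsUntwistedPAdicLFunction p f η α μ`,
  `η` primitive mod `p^c`, `α ≠ 0`, `ξ` primitive even of `p`-power order mod `p^c` and a primitive `χ` mod `p^c`
  realising `η̄ξ`: `∫_Γ ξ dμ = 0 ⟺ ratTwistedSymbolSum f ξ = 0` (the Jacobi constant is non-zero,
  `PSUntwistingJacobi.jacobi_ne_zero_of_compat`).  The levels `n ≥ 2c` are sibling cycu-p5's
  `PSUntwistNonvanishingCofinite.gammaCharValue_eq_zero_iff`; for `p = 3`, `c = 2` the remaining level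
  `n = 3` is `gammaCharValue_eq_zero_iff_twentySeven` (`PSUntwistingTwentySeven.gammaCharValue_eq_of_conductor_27`).
* §3 ROUTE LEVEL (`p = 3`, `η` primitive mod `9`, `α ≠ 0`): `gammaCharValue_eq_zero_iff_of_three_le`
  (**every `n ≥ 3`, `χ` built internally**), `hasSum_zero_iff_of_three_le` (power-series form:
  **`∑_k c_k (ξ(γ)−1)^k = 0 ⟺ ∑_a ξ(a)[a/3ⁿ]⁺_f = 0`**), the level-`9` versions `…_nine` (given a primitive
  `χ` mod `9` realising `η̄ξ`), and `exists_forall_hasSum_zero_iff_of_isPSCyclotomicLFunctionOf` for the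
  route's object with the newform `f` of `W`.  So on every Pollack–Stevens row the zero set of the typed
  `3`-adic `L`-function among `{ξ(γ) − 1}` is EXACTLY the set of wild `ξ` with vanishing Birch sum of `f_W`
  (by Birch's formula, the vanishing twisted values `L(E, ξ̄, 1)`), independently of `η` and `α`.

References: [cite: MazurTateTeitelbaum1986Invent, §I.8, §I.13 and §I.14]; [cite: Bellaiche2021, §6.7.3, Thm. 6.7.9].
-/

noncomputable section

open scoped MatrixGroups

open Finset Filter Topology Literature.NumberTheory.IwasawaTheory
  Literature.NumberTheory.EllipticCurves Literature.NumberTheory.EllipticCurves.ModularForms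
  DirichletCharacter
  Summit.BirchSwinnertonDyer.BirchSwinnertonDyer.Theorems.PSAmiceCharValues
  Summit.BirchSwinnertonDyer.BirchSwinnertonDyer.Theorems.PSUntwistNonvanishingCofinite
  Summit.BirchSwinnertonDyer.BirchSwinnertonDyer.Theorems.PSUntwistingJacobi
  Summit.BirchSwinnertonDyer.BirchSwinnertonDyer.Theorems.PSUntwistingTwentySeven
  Summit.BirchSwinnertonDyer.BirchSwinnertonDyer.Theorems.PSPrimePowerGauss

-- single-conjunct summit: `Summit.BirchSwinnertonDyer.BirchSwinnertonDyer.…` repeats the name by design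
set_option linter.dupNamespace false
set_option autoImplicit false

namespace Summit.BirchSwinnertonDyer.BirchSwinnertonDyer.Theorems.PSAmiceZeros

variable {p : ℕ} [hp : Fact p.Prime]

/-! ### §1 Zeros of the Amice series at `ξ(γ) − 1` are zeros of `∫_Γ ξ dμ` -/

section General

variable {μ : (n : ℕ) → ZMod (p ^ n) → ℂ_[p]}

/-- **`L_μ(ξ(γ) − 1) = 0 ⟺ ∫_Γ ξ dμ = 0`** for additive ball values of order `< 1` (uniqueness of the sum
of the convergent Amice series, `hasSum_gammaMahlerCoeff_mul_pow_gammaCharValue`).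
[cite: MazurTateTeitelbaum1986Invent, §I.13] -/
theorem hasSum_zero_iff_gammaCharValue_eq_zero (hμ : IsGammaDistribution p μ) {ν : ℝ}
    (hν : HasGrowthOrder p ν μ) (hν1 : ν < 1) {m : ℕ} (ξ : DirichletCharacter ℂ_[p] (p ^ m)) :
    HasSum (fun k ↦ gammaMahlerCoeff p μ k * (ξ (cyclotomicGenerator p : ZMod (p ^ m)) - 1) ^ k) 0 ↔
      gammaCharValue p μ ξ = 0 := by
  have h := hasSum_gammaMahlerCoeff_mul_pow_gammaCharValue hμ hν hν1 ξ
  constructor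
  · intro h0; exact h.unique h0
  · intro h0; rwa [h0] at h

end General

/-! ### §2 The value-level dictionary at the levels the first-moment files leave out -/

section Levels

variable {N : ℕ} [NeZero N] {f : CuspForm (CongruenceSubgroup.Gamma0 N) 2} {c : ℕ}
  {η : DirichletCharacter ℂ_[p] (p ^ c)} {α : ℂ_[p]} {μ : (n : ℕ) → ZMod (p ^ n) → ℂ_[p]}

/-- `e_n(α) ≠ 0` for `n ≥ 1`, `α ≠ 0` (`e_n(α) = α⁻ⁿ`). [cite: Bellaiche2021, Thm. 6.7.9] -/
theorem untwistMultiplier_ne_zero (hα : α ≠ 0) {n : ℕ} (hn : n ≠ 0) : untwistMultiplier p α n ≠ 0 := by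
  rw [untwistMultiplier_of_ne_zero α hn]
  exact pow_ne_zero _ (inv_ne_zero hα)

/-- **Level `n = c` (Jacobi)**: for `IsUntwistedPAdicLFunction p f η α μ` with `η` primitive mod `p^c`
(`c ≥ 1`), `α ≠ 0`, `ξ` primitive even of `p`-power order mod `p^c` and a primitive `χ` mod `p^c` realising
`η̄ξ`: `∫_Γ ξ dμ = 0 ⟺ ∑_a ξ(a)[a/p^c]⁺_f = 0` (`gammaCharValue_eq_jacobi`; the Jacobi sum is non-zero,
`jacobi_ne_zero_of_compat`). [cite: MazurTateTeitelbaum1986Invent, §I.14] -/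
theorem gammaCharValue_eq_zero_iff_jacobi (hμ : IsUntwistedPAdicLFunction p f η α μ) (hc : 0 < c)
    (hη : η.IsPrimitive) (hα : α ≠ 0) (ξ : DirichletCharacter ℂ_[p] (p ^ c)) (hξ : ξ.IsPrimitive)
    (hξe : ξ.Even) (hξo : ∃ j : ℕ, orderOf ξ = p ^ j) (χ : DirichletCharacter ℂ_[p] (p ^ c))
    (hχ : χ.IsPrimitive)
    (hcompat : ∀ a : ℕ, a.Coprime p → χ (a : ZMod (p ^ c)) = (η (a : ZMod (p ^ c)))⁻¹ * ξ (a : ZMod (p ^ c))) :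
    gammaCharValue p μ ξ = 0 ↔ ratTwistedSymbolSum f ξ = 0 := by
  rw [gammaCharValue_eq_jacobi hμ hc ξ hξ hξe hξo χ hχ hcompat]
  have h1 := untwistMultiplier_ne_zero (p := p) hα hc.ne'
  have h2 := jacobi_ne_zero_of_compat hc hη ξ hξ χ hχ hcompat
  constructor
  · intro h
    rcases mul_eq_zero.1 h with h' | h'
    · exact absurd h' h1
    · rcases mul_eq_zero.1 h' with h'' | h''
      · exact absurd h'' h2
      · exact h''
  · intro h; rw [h, mul_zero, mul_zero]

/-- **Level `27` for `p = 3`, `c = 2`**: for `IsUntwistedPAdicLFunction 3 f η α μ`, `η` primitive mod `9`,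
`α ≠ 0`, `ξ` primitive even of `3`-power order mod `27` and a primitive `χ` mod `27` realising `η̄ξ`:
`∫_Γ ξ dμ = 0 ⟺ ∑_a ξ(a)[a/27]⁺_f = 0` (`gammaCharValue_eq_of_conductor_27`, constant non-zero).
[cite: MazurTateTeitelbaum1986Invent, §I.14] -/
theorem gammaCharValue_eq_zero_iff_twentySeven {η : DirichletCharacter ℂ_[3] (3 ^ 2)} {α : ℂ_[3]}
    {μ : (n : ℕ) → ZMod (3 ^ n) → ℂ_[3]} (hμ : IsUntwistedPAdicLFunction 3 f η α μ)
    (hη : η.IsPrimitive) (hα : α ≠ 0) (ξ : DirichletCharacter ℂ_[3] (3 ^ 3)) (hξ : ξ.IsPrimitive)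
    (hξe : ξ.Even) (hξo : ∃ j : ℕ, orderOf ξ = 3 ^ j) (χ : DirichletCharacter ℂ_[3] (3 ^ 3))
    (hχ : χ.IsPrimitive)
    (hcompat : ∀ a : ℕ, a.Coprime 3 → χ (a : ZMod (3 ^ 3)) = (η (a : ZMod (3 ^ 2)))⁻¹ * ξ (a : ZMod (3 ^ 3))) :
    gammaCharValue 3 μ ξ = 0 ↔ ratTwistedSymbolSum f ξ = 0 := by
  obtain ⟨heq, hne⟩ := gammaCharValue_eq_of_conductor_27 hμ hη ξ hξ hξe hξo χ hχ hcompat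
  rw [heq]
  have h1 := untwistMultiplier_ne_zero (p := 3) hα (by norm_num : (3 : ℕ) ≠ 0)
  constructor
  · intro h
    rcases mul_eq_zero.1 h with h' | h'
    · exact absurd h' h1
    · rcases mul_eq_zero.1 h' with h'' | h''
      · exact absurd h'' hne
      · exact h''
  · intro h; rw [h, mul_zero, mul_zero]

end Levels

/-! ### §3 Route level: `p = 3`, `η` primitive mod `9` — every level `n ≥ 2` -/

section Route

variable {N : ℕ} [NeZero N] {f : CuspForm (CongruenceSubgroup.Gamma0 N) 2}
  {η : DirichletCharacter ℂ_[3] (3 ^ 2)} {α : ℂ_[3]} {μ : (n : ℕ) → ZMod (3 ^ n) → ℂ_[3]}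

/-- **`∫_Γ ξ dμ = 0 ⟺ ∑_a ξ(a)[a/3ⁿ]⁺_f = 0` for EVERY `n ≥ 3`** (`p = 3`, `η` primitive mod `9`, `α ≠ 0`,
`ξ` primitive even of `3`-power order mod `3ⁿ`; the primitive `χ = η̄ξ` mod `3ⁿ` is built internally,
`isPrimitive_inv_changeLevel_mul`): level `27` by `gammaCharValue_eq_zero_iff_twentySeven`, levels `≥ 81`
by cycu-p5's `gammaCharValue_eq_zero_iff`. [cite: MazurTateTeitelbaum1986Invent, §I.14] -/
theorem gammaCharValue_eq_zero_iff_of_three_le (hμ : IsUntwistedPAdicLFunction 3 f η α μ)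
    (hη : η.IsPrimitive) (hα : α ≠ 0) {n : ℕ} (hn : 3 ≤ n) (ξ : DirichletCharacter ℂ_[3] (3 ^ n))
    (hξ : ξ.IsPrimitive) (hξe : ξ.Even) (hξo : ∃ j : ℕ, orderOf ξ = 3 ^ j) :
    gammaCharValue 3 μ ξ = 0 ↔ ratTwistedSymbolSum f ξ = 0 := by
  by_cases h4 : 2 * 2 ≤ n
  · exact gammaCharValue_eq_zero_iff hμ (by norm_num) hη hα h4 ξ hξ hξe hξo
  · obtain rfl : n = 3 := by omega
    have hcn : 2 < 3 := by norm_num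
    set χ := changeLevel (pow_dvd_pow 3 hcn.le) η⁻¹ * ξ with hχ
    have hχprim : χ.IsPrimitive := isPrimitive_inv_changeLevel_mul η hcn ξ hξ
    have hcompat : ∀ a : ℕ, a.Coprime 3 →
        χ (a : ZMod (3 ^ 3)) = (η (a : ZMod (3 ^ 2)))⁻¹ * ξ (a : ZMod (3 ^ 3)) :=
      fun a ha ↦ inv_changeLevel_mul_apply_natCast η (by norm_num) hcn.le ξ a ha
    exact gammaCharValue_eq_zero_iff_twentySeven hμ hη hα ξ hξ hξe hξo χ hχprim hcompat

/-- **Power-series form, every `n ≥ 3`: `∑_k c_k (ξ(γ)−1)^k = 0 ⟺ ∑_a ξ(a)[a/3ⁿ]⁺_f = 0`** — the zeros of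
the typed `3`-adic `L`-function `L_μ(T)` at `T = ξ(γ) − 1` are exactly the wild `ξ` with vanishing Birch sum
of `f`. [cite: MazurTateTeitelbaum1986Invent, §I.13 and §I.14] -/
theorem hasSum_zero_iff_of_three_le (hμ : IsUntwistedPAdicLFunction 3 f η α μ) (hη : η.IsPrimitive)
    (hα : α ≠ 0) {n : ℕ} (hn : 3 ≤ n) (ξ : DirichletCharacter ℂ_[3] (3 ^ n)) (hξ : ξ.IsPrimitive)
    (hξe : ξ.Even) (hξo : ∃ j : ℕ, orderOf ξ = 3 ^ j) :
    HasSum (fun k ↦ gammaMahlerCoeff 3 μ k * (ξ (cyclotomicGenerator 3 : ZMod (3 ^ n)) - 1) ^ k) 0 ↔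
      ratTwistedSymbolSum f ξ = 0 := by
  rw [hasSum_zero_iff_gammaCharValue_eq_zero hμ.isGammaDistribution hμ.hasGrowthOrder (by norm_num) ξ]
  exact gammaCharValue_eq_zero_iff_of_three_le hμ hη hα hn ξ hξ hξe hξo

/-- **Level `9`** (`n = 2 = c`): given a primitive `χ` mod `9` realising `η̄ξ` (for `ξ ≠ η` on the units),
`∫_Γ ξ dμ = 0 ⟺ ∑_a ξ(a)[a/9]⁺_f = 0` (Jacobi case). [cite: MazurTateTeitelbaum1986Invent, §I.14] -/
theorem gammaCharValue_eq_zero_iff_nine (hμ : IsUntwistedPAdicLFunction 3 f η α μ) (hη : η.IsPrimitive)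
    (hα : α ≠ 0) (ξ : DirichletCharacter ℂ_[3] (3 ^ 2)) (hξ : ξ.IsPrimitive) (hξe : ξ.Even)
    (hξo : ∃ j : ℕ, orderOf ξ = 3 ^ j) (χ : DirichletCharacter ℂ_[3] (3 ^ 2)) (hχ : χ.IsPrimitive)
    (hcompat : ∀ a : ℕ, a.Coprime 3 → χ (a : ZMod (3 ^ 2)) = (η (a : ZMod (3 ^ 2)))⁻¹ * ξ (a : ZMod (3 ^ 2))) :
    gammaCharValue 3 μ ξ = 0 ↔ ratTwistedSymbolSum f ξ = 0 :=
  gammaCharValue_eq_zero_iff_jacobi hμ (by norm_num) hη hα ξ hξ hξe hξo χ hχ hcompat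

/-- **Level `9`, power-series form.** [cite: MazurTateTeitelbaum1986Invent, §I.13 and §I.14] -/
theorem hasSum_zero_iff_nine (hμ : IsUntwistedPAdicLFunction 3 f η α μ) (hη : η.IsPrimitive)
    (hα : α ≠ 0) (ξ : DirichletCharacter ℂ_[3] (3 ^ 2)) (hξ : ξ.IsPrimitive) (hξe : ξ.Even)
    (hξo : ∃ j : ℕ, orderOf ξ = 3 ^ j) (χ : DirichletCharacter ℂ_[3] (3 ^ 2)) (hχ : χ.IsPrimitive)
    (hcompat : ∀ a : ℕ, a.Coprime 3 → χ (a : ZMod (3 ^ 2)) = (η (a : ZMod (3 ^ 2)))⁻¹ * ξ (a : ZMod (3 ^ 2))) :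
    HasSum (fun k ↦ gammaMahlerCoeff 3 μ k * (ξ (cyclotomicGenerator 3 : ZMod (3 ^ 2)) - 1) ^ k) 0 ↔
      ratTwistedSymbolSum f ξ = 0 := by
  rw [hasSum_zero_iff_gammaCharValue_eq_zero hμ.isGammaDistribution hμ.hasGrowthOrder (by norm_num) ξ]
  exact gammaCharValue_eq_zero_iff_nine hμ hη hα ξ hξ hξe hξo χ hχ hcompat

/-- **The route's object**: for `IsPSCyclotomicLFunctionOf W η α μ` with `η` primitive mod `9`, `α ≠ 0`,
and the newform `f` of `W`: for every `n ≥ 3` and every primitive even `ξ` mod `3ⁿ` of `3`-power order,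
`L_μ(ξ(γ) − 1) = 0 ⟺ ∑_a ξ(a)[a/3ⁿ]⁺_f = 0` — the zeros of the typed principal-series `3`-adic
`L`-function at the wild characters are the vanishing Birch sums of `f_W` (Birch: the vanishing twisted
values `L(W, ξ̄, 1)`), whatever `η` and `α`. [cite: MazurTateTeitelbaum1986Invent, §I.8 and §I.14] -/
theorem exists_forall_hasSum_zero_iff_of_isPSCyclotomicLFunctionOf {W : WeierstrassCurve ℚ}
    (hμ : IsPSCyclotomicLFunctionOf W η α μ) (hη : η.IsPrimitive) (hα : α ≠ 0) :
    ∃ (N : ℕ) (_ : NeZero N) (f : CuspForm (CongruenceSubgroup.Gamma0 N) 2), IsNewformOf W f ∧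
      ∀ (n : ℕ), 3 ≤ n → ∀ ξ : DirichletCharacter ℂ_[3] (3 ^ n), ξ.IsPrimitive → ξ.Even →
        (∃ j : ℕ, orderOf ξ = 3 ^ j) →
        (HasSum (fun k ↦ gammaMahlerCoeff 3 μ k * (ξ (cyclotomicGenerator 3 : ZMod (3 ^ n)) - 1) ^ k) 0 ↔
          ratTwistedSymbolSum f ξ = 0) := by
  obtain ⟨N, hN, f, hf, hμf⟩ := hμ
  exact ⟨N, hN, f, hf, fun n hn ξ hξ hξe hξo ↦ hasSum_zero_iff_of_three_le hμf hη hα hn ξ hξ hξe hξo⟩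

end Route

end Summit.BirchSwinnertonDyer.BirchSwinnertonDyer.Theorems.PSAmiceZeros

end
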